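import Summits.HubbardSuperconductivity.HubbardLadder.EigenWindowRows

/-!
# Eigen-window rows for OBSERVABLE windows (family F11 on the R2 device)

HONEST FRAMING (page 1): ladder R1–R4 with certified numbers; no claim on H/H₀. This file is a
SOUNDNESS EDGE (pub-hubbard cell, seat `pseudo`, family F11 of `PSEUDO.md` §1 / `TO-ENG.md` §A);
no certificate using it exists yet.

`EigenWindowRows` reads a certificate identity with the two eigen-window terms
`eigWindowLo H E_lo W₁ M₁ + eigWindowUp H E_up W₂ M₂` (`W₁, W₂ ⪰ 0`, certified window
`E_lo ≤ E ≤ E_up`) for the objective `H` itself (energy floors). With an arbitrary objective `V`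
on the left the same two nonnegative terms give `c − ε ≤ Re ω(V)`
(`le_re_map_of_certificate_eigWindow`): the observable-window certificate of the R2 device
(`ObservableWindowAbstract` / `ObservableWindowVector`, scalar window `μ·(E_up·1 − H)`, i.e. "a
state with `ω(H) ≤ E_up`") strengthened to "an EIGENSTATE with `E_lo ≤ E ≤ E_up`" — primal LMIs
`E_lo·M ⪯ Z ⪯ E_up·M`, `M = [ω(Mᵢ⋆Mⱼ)]`, `Z = [ω(½{H, Mᵢ⋆Mⱼ})]`, which force
`ω(Mᵢ⋆(H − E)Mⱼ)`-type variances to vanish as the window closes. The scalar window is the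
one-letter case `M = 1`, `W = (μ)` of `eigWindowUp` (`eigWindowUp_const_one`), so every R2 window
certificate is an instance. Matrix instances in the R2 shapes: a unit eigenvector with commutator
and sector-annihilator null terms and a residual (`re_vectorState_ge_of_certificate_eigWindow`,
cf. `re_vectorState_ge_of_windowCertificate_residual`); every sector ground state
(`re_expect_ge_of_certificate_eigWindow_of_sectorGS`); the tracial ground state with symmetry
defects (`re_groundStateFunctional_ge_of_certificate_eigWindow`). `E_lo` is an earlier certified
SDP floor for the same Hamiltonian/sector, `E_up` a certified trial-state energy (R1). All PROVED.

References: Han–Hartnoll–Kruthoff, PRL 125 (2020) 041601 = arXiv:2004.10212, p. 2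
[cite: HanHartnollKruthoff2020, p. 2]; Wang et al., PRX 2024 §3 eq. (4) (energy-window observable
SDP) [cite: WangEtAl2024, §3 eq. (4)]; Kull–Schuch–Dive–Navascués, PRX 14 (2024) 021008 §5.3
[cite: KullEtAl2024, §5.3].
-/

noncomputable section

open Matrix Finset Literature.MathematicalPhysics.QuantumManyBody.StateRelaxation
open Literature.MathematicalPhysics.QuantumLattice hiding vectorState vectorState_apply
open scoped ComplexOrder MatrixOrder BigOperators

namespace Summit.HubbardSuperconductivity.HubbardLadder

/-! ### Abstract `⋆`-algebra -/

section Abstract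

variable {𝓐 : Type*} [Ring 𝓐] [StarRing 𝓐] [Algebra ℂ 𝓐] [StarModule ℂ 𝓐]
variable {m : Type*} [Fintype m]

omit [StarModule ℂ 𝓐] [Fintype m] in
/-- The scalar energy window `μ·(E·1 − h)` of the R2 observable device
(`le_re_map_of_windowCertificate_residual`) is the one-letter case `M = 1`, `W = (μ)` of the upper
eigen-window element. [folklore] -/
theorem eigWindowUp_const_one (h : 𝓐) (E : ℝ) (μ : ℂ) :
    eigWindowUp h E (Matrix.of fun (_ _ : Unit) => μ) (fun _ => (1 : 𝓐)) =
      μ • ((E : ℂ) • (1 : 𝓐) - h) := by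
  have h2 : (2 : ℂ)⁻¹ • (h + h) = h := by
    rw [← two_smul ℂ h, smul_smul, inv_mul_cancel₀ (two_ne_zero' ℂ), one_smul]
  simp only [eigWindowUp, Finset.univ_unique, Finset.sum_singleton, Matrix.of_apply, star_one,
    mul_one, one_mul, h2]

/-- **Weak duality with eigen-window terms, any objective `v`.** A positive normalised functional
with the two-sided eigen property for `h` at `E`, a certified window `E_lo ≤ E ≤ E_up` and an
identity `v − c·1 = gramForm Λ O + n + (eigWindowLo h E_lo W₁ M₁ + eigWindowUp h E_up W₂ M₂ + r)`
with `Λ, W₁, W₂ ⪰ 0`, `ω(n) = 0`, `−ε ≤ Re ω(r)` give `c − ε ≤ Re ω(v)` (for `v = h` this is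
`le_of_certificate_eigWindow`). [cite: HanHartnollKruthoff2020, p. 2] -/
theorem le_re_map_of_certificate_eigWindow [DecidableEq m] (ω : 𝓐 →ₗ[ℂ] ℂ)
    (hpos : ∀ a, 0 ≤ ω (star a * a)) (hone : ω 1 = 1) {h : 𝓐} {E : ℝ}
    (hL : ∀ x, ω (h * x) = (E : ℂ) * ω x) (hR : ∀ x, ω (x * h) = (E : ℂ) * ω x)
    {Λ : Matrix m m ℂ} (hΛ : Λ.PosSemidef) (O : m → 𝓐) {n r : 𝓐} (hn : ω n = 0)
    {m₁ : Type*} [Fintype m₁] [DecidableEq m₁] {W₁ : Matrix m₁ m₁ ℂ} (hW₁ : W₁.PosSemidef)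
    (M₁ : m₁ → 𝓐) {E_lo : ℝ} (hlo : E_lo ≤ E)
    {m₂ : Type*} [Fintype m₂] [DecidableEq m₂] {W₂ : Matrix m₂ m₂ ℂ} (hW₂ : W₂.PosSemidef)
    (M₂ : m₂ → 𝓐) {E_up : ℝ} (hup : E ≤ E_up)
    {ε : ℝ} (hr : -ε ≤ (ω r).re) {v : 𝓐} {c : ℝ}
    (hcert : v - (c : ℂ) • (1 : 𝓐) =
      gramForm Λ O + n + (eigWindowLo h E_lo W₁ M₁ + eigWindowUp h E_up W₂ M₂ + r)) :
    c - ε ≤ (ω v).re := by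
  have h1 : 0 ≤ (ω (eigWindowLo h E_lo W₁ M₁)).re :=
    (Complex.nonneg_iff.mp (map_eigWindowLo_nonneg ω hpos hL hR hlo hW₁ M₁)).1
  have h2 : 0 ≤ (ω (eigWindowUp h E_up W₂ M₂)).re :=
    (Complex.nonneg_iff.mp (map_eigWindowUp_nonneg ω hpos hL hR hup hW₂ M₂)).1
  have hr' : -ε ≤ (ω (eigWindowLo h E_lo W₁ M₁ + eigWindowUp h E_up W₂ M₂ + r)).re := by
    rw [map_add, map_add, Complex.add_re, Complex.add_re]
    linarith
  exact le_re_map_of_certificate_residual ω hpos hone hΛ O hn hr' hcert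

end Abstract

/-! ### Matrix instances in the shapes of the R2 device -/

section MatrixInstances

variable {n : Type*} [Fintype n] [DecidableEq n] {m : Type*} [Fintype m] [DecidableEq m]

/-- **Eigen-window observable certificate, unit eigenvector.** For Hermitian `A`, a unit
eigenvector `A v = E v`, a certified window `E_lo ≤ E ≤ E_up` and an identity
`V − c·1 = gramForm Λ O + (Σₖ (A Xₖ − Xₖ A) + Σₗ (Yₗ Zₗ + Z'ₗ Y'ₗ))
  + (eigWindowLo A E_lo W₁ M₁ + eigWindowUp A E_up W₂ M₂ + r)`
with `Λ, W₁, W₂ ⪰ 0`, `Zₗ v = 0`, `Z'ₗᴴ v = 0`, `−ε ≤ Re ⟨v, r v⟩`: `c − ε ≤ Re ⟨v, V v⟩`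
(cf. `re_vectorState_ge_of_windowCertificate_residual`, the case `M₂ = 1`, `W₂ = (μ)`, `W₁ = 0`).
[cite: HanHartnollKruthoff2020, p. 2] [cite: WangEtAl2024, §3 eq. (4)] -/
theorem re_vectorState_ge_of_certificate_eigWindow {A : Matrix n n ℂ} (hA : A.IsHermitian)
    {E : ℝ} {v : n → ℂ} (hv : star v ⬝ᵥ v = 1) (hAv : A *ᵥ v = (E : ℂ) • v)
    {Λ : Matrix m m ℂ} (hΛ : Λ.PosSemidef) (O : m → Matrix n n ℂ)
    {κ : Type*} (s : Finset κ) (X : κ → Matrix n n ℂ)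
    {ι : Type*} (t : Finset ι) (Y Z Z' Y' : ι → Matrix n n ℂ)
    (hZ : ∀ l ∈ t, Z l *ᵥ v = 0) (hZ' : ∀ l ∈ t, (Z' l)ᴴ *ᵥ v = 0)
    {m₁ : Type*} [Fintype m₁] [DecidableEq m₁] {W₁ : Matrix m₁ m₁ ℂ} (hW₁ : W₁.PosSemidef)
    (M₁ : m₁ → Matrix n n ℂ) {E_lo : ℝ} (hlo : E_lo ≤ E)
    {m₂ : Type*} [Fintype m₂] [DecidableEq m₂] {W₂ : Matrix m₂ m₂ ℂ} (hW₂ : W₂.PosSemidef)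
    (M₂ : m₂ → Matrix n n ℂ) {E_up : ℝ} (hup : E ≤ E_up)
    {V r : Matrix n n ℂ} {ε : ℝ} (hr : -ε ≤ (star v ⬝ᵥ r *ᵥ v).re) {c : ℝ}
    (hcert : V - (c : ℂ) • (1 : Matrix n n ℂ) =
      gramForm Λ O + (∑ k ∈ s, (A * X k - X k * A) + ∑ l ∈ t, (Y l * Z l + Z' l * Y' l)) +
        (eigWindowLo A E_lo W₁ M₁ + eigWindowUp A E_up W₂ M₂ + r)) :
    c - ε ≤ (star v ⬝ᵥ V *ᵥ v).re := by
  set ω := vectorState v with hω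
  have hpos : ∀ a : Matrix n n ℂ, 0 ≤ ω (star a * a) := fun a => vectorState_nonneg v a
  have hone : ω 1 = 1 := by rw [hω, vectorState_apply, one_mulVec, hv]
  have hL : ∀ x, ω (A * x) = (E : ℂ) * ω x := fun x => vectorState_mul_left_of_eigenvector hA hAv x
  have hR : ∀ x, ω (x * A) = (E : ℂ) * ω x := fun x => vectorState_mul_right_of_eigenvector hAv x
  have hnull : ω (∑ k ∈ s, (A * X k - X k * A) + ∑ l ∈ t, (Y l * Z l + Z' l * Y' l)) = 0 := by
    rw [map_add, map_sum, map_sum]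
    have h1 : ∀ k ∈ s, ω (A * X k - X k * A) = 0 := fun k _ => vectorState_commutator hA hAv _
    have h2 : ∀ l ∈ t, ω (Y l * Z l + Z' l * Y' l) = 0 := fun l hl => by
      rw [map_add, hω, vectorState_mul_of_mulVec_eq_zero v _ (hZ l hl),
        vectorState_mul_of_conjTranspose_mulVec_eq_zero v _ (hZ' l hl), add_zero]
    rw [Finset.sum_eq_zero h1, Finset.sum_eq_zero h2, add_zero]
  have hr' : -ε ≤ (ω r).re := by rw [hω, vectorState_apply]; exact hr
  have h := le_re_map_of_certificate_eigWindow ω hpos hone hL hR hΛ O hnull hW₁ M₁ hlo hW₂ M₂ hup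
    hr' hcert
  rwa [hω, vectorState_apply] at h

/-- **Every sector ground state** (the quantifier of `PairCorrWindowCert.sound`): for Hermitian
`A`, a sector `K` with a certified window `E_lo ≤ minEnergyOn A K ≤ E_up` (an earlier `certsdp`
floor for the same sector; R1's trial state via `minEnergyOn_le_of_trialState`), annihilators valid
on all of `K`, a residual bound on unit vectors of `K`, and the identity of
`re_vectorState_ge_of_certificate_eigWindow`: every unit `ψ ∈ K` with `A ψ = E_K ψ` has
`c − ε ≤ Re ⟨ψ, V ψ⟩`. [cite: HanHartnollKruthoff2020, p. 2] [cite: WangEtAl2024, §3 eq. (4)] -/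
theorem re_expect_ge_of_certificate_eigWindow_of_sectorGS {A : Matrix n n ℂ} (hA : A.IsHermitian)
    (K : Submodule ℂ (n → ℂ)) {Λ : Matrix m m ℂ} (hΛ : Λ.PosSemidef) (O : m → Matrix n n ℂ)
    {κ : Type*} (s : Finset κ) (X : κ → Matrix n n ℂ)
    {ι : Type*} (t : Finset ι) (Y Z Z' Y' : ι → Matrix n n ℂ)
    (hZ : ∀ l ∈ t, ∀ w ∈ K, Z l *ᵥ w = 0) (hZ' : ∀ l ∈ t, ∀ w ∈ K, (Z' l)ᴴ *ᵥ w = 0)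
    {m₁ : Type*} [Fintype m₁] [DecidableEq m₁] {W₁ : Matrix m₁ m₁ ℂ} (hW₁ : W₁.PosSemidef)
    (M₁ : m₁ → Matrix n n ℂ) {E_lo : ℝ} (hlo : E_lo ≤ A.minEnergyOn K)
    {m₂ : Type*} [Fintype m₂] [DecidableEq m₂] {W₂ : Matrix m₂ m₂ ℂ} (hW₂ : W₂.PosSemidef)
    (M₂ : m₂ → Matrix n n ℂ) {E_up : ℝ} (hup : A.minEnergyOn K ≤ E_up)
    {V r : Matrix n n ℂ} {ε : ℝ}
    (hr : ∀ w ∈ K, star w ⬝ᵥ w = 1 → -ε ≤ (star w ⬝ᵥ r *ᵥ w).re) {c : ℝ}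
    (hcert : V - (c : ℂ) • (1 : Matrix n n ℂ) =
      gramForm Λ O + (∑ k ∈ s, (A * X k - X k * A) + ∑ l ∈ t, (Y l * Z l + Z' l * Y' l)) +
        (eigWindowLo A E_lo W₁ M₁ + eigWindowUp A E_up W₂ M₂ + r))
    {ψ : n → ℂ} (hψK : ψ ∈ K) (hψ1 : star ψ ⬝ᵥ ψ = 1)
    (hAψ : A *ᵥ ψ = ((A.minEnergyOn K : ℝ) : ℂ) • ψ) :
    c - ε ≤ (star ψ ⬝ᵥ V *ᵥ ψ).re :=
  re_vectorState_ge_of_certificate_eigWindow hA hψ1 hAψ hΛ O s X t Y Z Z' Y'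
    (fun l hl => hZ l hl ψ hψK) (fun l hl => hZ' l hl ψ hψK) hW₁ M₁ hlo hW₂ M₂ hup
    (hr ψ hψK hψ1) hcert

/-- **Eigen-window observable certificate, tracial ground state with symmetry defects.** For
Hermitian `A` with a certified window `E_lo ≤ E₀(A) ≤ E_up`: an identity
`V − c·1 = gramForm Λ O + (Σₖ (A Xₖ − Xₖ A) + Σₗ (Uₗ Yₗ Uₗᴴ − Yₗ))
  + (eigWindowLo A E_lo W₁ M₁ + eigWindowUp A E_up W₂ M₂ + r)`
with `Λ, W₁, W₂ ⪰ 0`, unitaries `Uₗ` commuting with `A` and `−ε ≤ Re ω₀(r)` proves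
`c − ε ≤ Re ω₀(V)` for `ω₀ = Matrix.groundStateFunctional A` (cf.
`re_groundStateFunctional_ge_of_windowCertificate_residual`; Heisenberg rows of the R2 device).
[cite: HanHartnollKruthoff2020, p. 2] [cite: WangEtAl2024, §3 eq. (4)] -/
theorem re_groundStateFunctional_ge_of_certificate_eigWindow [Nonempty n] {A : Matrix n n ℂ}
    (hA : A.IsHermitian) {Λ : Matrix m m ℂ} (hΛ : Λ.PosSemidef) (O : m → Matrix n n ℂ)
    {κ : Type*} (s : Finset κ) (X : κ → Matrix n n ℂ)
    {ι : Type*} (t : Finset ι) (U Y : ι → Matrix n n ℂ)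
    (hU : ∀ l ∈ t, U l * A = A * U l) (hUU : ∀ l ∈ t, (U l)ᴴ * U l = 1)
    {m₁ : Type*} [Fintype m₁] [DecidableEq m₁] {W₁ : Matrix m₁ m₁ ℂ} (hW₁ : W₁.PosSemidef)
    (M₁ : m₁ → Matrix n n ℂ) {E_lo : ℝ} (hlo : E_lo ≤ A.groundEnergy)
    {m₂ : Type*} [Fintype m₂] [DecidableEq m₂] {W₂ : Matrix m₂ m₂ ℂ} (hW₂ : W₂.PosSemidef)
    (M₂ : m₂ → Matrix n n ℂ) {E_up : ℝ} (hup : A.groundEnergy ≤ E_up)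
    {V r : Matrix n n ℂ} {ε : ℝ} (hr : -ε ≤ (A.groundStateFunctional r).re) {c : ℝ}
    (hcert : V - (c : ℂ) • (1 : Matrix n n ℂ) =
      gramForm Λ O + (∑ k ∈ s, (A * X k - X k * A) + ∑ l ∈ t, (U l * Y l * (U l)ᴴ - Y l)) +
        (eigWindowLo A E_lo W₁ M₁ + eigWindowUp A E_up W₂ M₂ + r)) :
    c - ε ≤ (A.groundStateFunctional V).re := by
  set ω := A.groundStateFunctional with hω
  have hpos : ∀ a : Matrix n n ℂ, 0 ≤ ω (star a * a) := fun a => by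
    rw [hω, Matrix.star_eq_conjTranspose]; exact Matrix.groundStateFunctional_nonneg A a
  have hone : ω 1 = 1 := Matrix.groundStateFunctional_one hA
  have hL : ∀ x, ω (A * x) = ((A.groundEnergy : ℝ) : ℂ) * ω x := fun x =>
    Matrix.groundStateFunctional_hamiltonian_mul hA x
  have hR : ∀ x, ω (x * A) = ((A.groundEnergy : ℝ) : ℂ) * ω x := fun x =>
    Matrix.groundStateFunctional_mul_hamiltonian A x
  have hnull : ω (∑ k ∈ s, (A * X k - X k * A) + ∑ l ∈ t, (U l * Y l * (U l)ᴴ - Y l)) = 0 := by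
    rw [map_add, map_sum, map_sum]
    have h1 : ∀ k ∈ s, ω (A * X k - X k * A) = 0 := fun k _ => by
      rw [map_sub, hL, hR, sub_self]
    have h2 : ∀ l ∈ t, ω (U l * Y l * (U l)ᴴ - Y l) = 0 := fun l hl => by
      rw [map_sub, hω, Matrix.groundStateFunctional_conj_of_commute hA (hU l hl) (hUU l hl),
        sub_self]
    rw [Finset.sum_eq_zero h1, Finset.sum_eq_zero h2, add_zero]
  exact le_re_map_of_certificate_eigWindow ω hpos hone hL hR hΛ O hnull hW₁ M₁ hlo hW₂ M₂ hup
    hr hcert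

end MatrixInstances

end Summit.HubbardSuperconductivity.HubbardLadder
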